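import Mathlib
import HarnessLib

/-!
# Route `UnitScaleTilt`, crux K1 «MinimiserStabilityRegPr» (stmt-QuantumFields-19200), route-R E′ (A′) «HCOW-VIA-Σ» (★★OWNER RULING g28-№13), package P-A2 «JOINT-Σ», row F4″ input —
# **THE JOINT ROW FROM LEVEL MASSES WITH A PERTURBED DAMPING `κ ≤ q·L⁻²`, `q < L`** (real bookkeeping at d = 3): the `q`-twin of ✓`Prop7JointRowOfLevelMasses` (routeR-w6 g3, F4 of (n3)).
# With per-level sources `r_l ≤ C·M_l`, level masses `M_l ≤ A·L^{−l} + B·L^{l}` and a damping factor `κ` with `0 ≤ κ ≤ q·(L²)⁻¹`, `0 ≤ q < L`: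
# `Σ_{l<k} κ^{k−1−l}·M_l ≤ A·(L²∕(L−q))·L^{−k} + B·(L²∕(L³−q))·L^{k}` — both channels still geometric from the top (ratios `q∕L < 1`, `q∕L³ < 1`).

Cell `ym3-torus`, D-0154 (3c) twin-width seat `ym-routeR-w3` (gen 7).  THEOREMS ONLY (0 `def`, 0 `sorry`); `--supports stmt-QuantumFields-19200`, count-neutral.  YM₃ on T³ is a ladder
rung (R3), not the Clay problem; nothing here claims the stub, the crux, d = 4 or the mass gap.

WHY.  px18 g3's ✓`Prop7CovLogTower.l1_CmapTwS_le_damped_defects` (F0″-b) telescopes the chart remainder with a CONSTANT column-sum letter `κ` (`Σ_{l<K−n} κ^{K−n−1−l}·Σ_c‖defect_l‖`), and the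
covariant damping supplied by this seat's F2″-COV member row ✓`Prop7TwistedOneStepLinL1OfRegPr.sum_norm_fderiv_dbarChartField_apply_le_of_regPr` is `κ = L⁻²·(1 + 2·10¹⁵·L⁵·ε₀)` — equal to
print's `L^{1−d} = L⁻²` only at `ε₀ = 0`.  ✓`jointRow_of_levelMasses` hard-codes `(L²)⁻¹`; this file is its verbatim re-run at `κ ≤ q·L⁻²` (`q = 1 + 2·10¹⁵L⁵ε₀ ≤ 2 < 3 ≤ L` under an
L-only window), so F4″ reads the F0″∕F1″∕F2″∕F3″ rows by `exact` with constants `L²∕(L−q)`, `L²∕(L³−q)` in place of `L²∕(L−1)`, `L²∕(L³−1)`.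

WHAT IS PROVED (ns `…Theorems.Prop7JointRowOfLevelMassesQ`; reals only, every input displayed).
* §1 `geom_sum_range_le_of_lt_one`, `damped_term_eq` (the exponent bookkeeping `(q∕L²)^{k−1−l}·(A·L^{−l} + B·L^{l}) = A·L^{−(k−1)}·(q∕L)^{k−1−l} + B·L^{k−1}·(q∕L³)^{k−1−l}`),
  ★ `levelSum_damped_le_q`.
* §2 ★★ `jointRow_of_levelMasses_q` — `E·Σ_{l<k} κ^{k−1−l}·r_l ≤ E·C·(A·(L²∕(L−q))·(L^k)⁻¹ + B·(L²∕(L³−q))·L^k)`.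
* §3 ★★ `jointRow_currency_q` — with `A = c_A·M₀`, `B = c_B·KD + c_B′·ε·(L^k)⁻²·M₀`: `C₁·(L^k)⁻¹·M₀ + C₂·L^k·KD`, `C₁ = E·C·(c_A·L²∕(L−q) + c_B′·ε·L²∕(L³−q))`, `C₂ = E·C·c_B·L²∕(L³−q)`.
HONEST SCOPE.  Pure real bookkeeping; the tower instantiation is the F4″ knit (★p1 g17).  At `q = 1` this is ✓`Prop7JointRowOfLevelMasses` (not re-derived from it: the closed forms differ).

References: T. Bałaban, CMP **95** (1984) 17–40 [Balaban1984PropagatorsI] ((1.18)–(1.20) pp.19–20); CMP **98** (1985) 17–51 [Balaban1985Averaging] ((150)–(152) p.40);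
CMP **102** (1985) 277–309 [Balaban1985Variational] (Prop. 7 p.299).
-/

set_option autoImplicit false

noncomputable section

open Finset
open scoped BigOperators

namespace Summit.QuantumFields.YangMills.Theorems.Prop7JointRowOfLevelMassesQ

/-! ## §1 The damped level sum with ratio `κ ≤ q·L⁻²` -/

/-- `Σ_{j<k} x^j ≤ 1∕(1−x)` for `0 ≤ x < 1`. [folklore] -/
theorem geom_sum_range_le_of_lt_one {x : ℝ} (hx : 0 ≤ x) (hx1 : x < 1) (k : ℕ) : ∑ j ∈ range k, x ^ j ≤ 1 / (1 - x) := by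
  have h := geom_sum_Ico_le_of_lt_one (m := 0) (n := k) hx hx1
  rwa [pow_zero, ← range_eq_Ico] at h

/-- The exponent bookkeeping: for `l < k`, `(q·(L²)⁻¹)^{k−1−l}·(A·(L^l)⁻¹ + B·L^l) = A·(L^{k−1})⁻¹·(q∕L)^{k−1−l} + B·L^{k−1}·(q∕L³)^{k−1−l}` (`L ≠ 0`). [folklore] -/
theorem damped_term_eq {L : ℝ} (hL : L ≠ 0) (q A B : ℝ) {k l : ℕ} (hlk : l < k) :
    (q * (L ^ 2)⁻¹) ^ (k - 1 - l) * (A * (L ^ l)⁻¹ + B * L ^ l) =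
      A * (L ^ (k - 1))⁻¹ * (q / L) ^ (k - 1 - l) + B * L ^ (k - 1) * (q / L ^ 3) ^ (k - 1 - l) := by
  obtain ⟨i, hi⟩ : ∃ i, k - 1 - l = i := ⟨_, rfl⟩
  have hk : k - 1 = i + l := by omega
  rw [hi, hk, pow_add]
  have hLi : L ^ i ≠ 0 := pow_ne_zero _ hL
  have hLl : L ^ l ≠ 0 := pow_ne_zero _ hL
  have e1 : (q * (L ^ 2)⁻¹) ^ i = q ^ i * ((L ^ i)⁻¹ * (L ^ i)⁻¹) := by
    rw [mul_pow, inv_pow, ← pow_mul, show 2 * i = i + i by ring, pow_add, mul_inv]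
  have e2 : (q / L) ^ i = q ^ i * (L ^ i)⁻¹ := by rw [div_pow, div_eq_mul_inv]
  have e3 : (q / L ^ 3) ^ i = q ^ i * ((L ^ i)⁻¹ * (L ^ i)⁻¹ * (L ^ i)⁻¹) := by
    rw [div_pow, ← pow_mul, show 3 * i = i + i + i by ring, pow_add, pow_add, div_eq_mul_inv, mul_inv, mul_inv]
  rw [e1, e2, e3]
  field_simp

/-- ★ **DAMPED LEVEL SUM, PERTURBED RATIO**: if `M_l ≤ A·L^{−l} + B·L^{l}` for `l < k` (`A, B ≥ 0`, `L ≥ 2`) and `0 ≤ κ ≤ q·(L²)⁻¹` with `0 ≤ q < L`, then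
`Σ_{l<k} κ^{k−1−l}·M_l ≤ A·(L²∕(L−q))·L^{−k} + B·(L²∕(L³−q))·L^{k}`. [cite: Balaban1984PropagatorsI, (1.18)-(1.20) pp.19-20] -/
theorem levelSum_damped_le_q (L : ℝ) (hL : 2 ≤ L) {q κ : ℝ} (hq0 : 0 ≤ q) (hqL : q < L) (hκ0 : 0 ≤ κ) (hκ : κ ≤ q * (L ^ 2)⁻¹)
    (k : ℕ) (A B : ℝ) (hA : 0 ≤ A) (hB : 0 ≤ B) (M : ℕ → ℝ) (hM : ∀ l < k, M l ≤ A * (L ^ l)⁻¹ + B * L ^ l) :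
    ∑ l ∈ range k, κ ^ (k - 1 - l) * M l ≤ A * (L ^ 2 / (L - q)) * (L ^ k)⁻¹ + B * (L ^ 2 / (L ^ 3 - q)) * L ^ k := by
  have hL0 : 0 < L := by linarith
  have hL3 : L ≤ L ^ 3 := by nlinarith [sq_nonneg L, hL0]
  have hx1 : q / L < 1 := (div_lt_one hL0).2 hqL
  have hx3 : q / L ^ 3 < 1 := (div_lt_one (by positivity)).2 (lt_of_lt_of_le hqL hL3)
  have hx10 : 0 ≤ q / L := by positivity
  have hx30 : 0 ≤ q / L ^ 3 := by positivity
  -- termwise: `κ^i·M_l ≤ (qL⁻²)^i·(A L^{−l} + B L^l)`, then the exponent bookkeeping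
  have hterm : ∀ l ∈ range k, κ ^ (k - 1 - l) * M l ≤
      A * (L ^ (k - 1))⁻¹ * (q / L) ^ (k - 1 - l) + B * L ^ (k - 1) * (q / L ^ 3) ^ (k - 1 - l) := by
    intro l hl
    have hlk : l < k := mem_range.mp hl
    have hS0 : 0 ≤ A * (L ^ l)⁻¹ + B * L ^ l := by positivity
    rw [← damped_term_eq hL0.ne' q A B hlk]
    calc κ ^ (k - 1 - l) * M l ≤ κ ^ (k - 1 - l) * (A * (L ^ l)⁻¹ + B * L ^ l) := mul_le_mul_of_nonneg_left (hM l hlk) (pow_nonneg hκ0 _)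
      _ ≤ (q * (L ^ 2)⁻¹) ^ (k - 1 - l) * (A * (L ^ l)⁻¹ + B * L ^ l) :=
          mul_le_mul_of_nonneg_right (pow_le_pow_left₀ hκ0 hκ _) hS0
  have hLq : 0 < L - q := by linarith
  have hL3q : 0 < L ^ 3 - q := by linarith
  -- `k = 0`: empty sum
  rcases Nat.eq_zero_or_pos k with hk | hk
  · subst hk
    rw [sum_range_zero]
    positivity
  refine (sum_le_sum hterm).trans ?_
  rw [sum_add_distrib, ← mul_sum, ← mul_sum, sum_range_reflect (fun j => (q / L) ^ j) k, sum_range_reflect (fun j => (q / L ^ 3) ^ j) k]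
  have hg1 := geom_sum_range_le_of_lt_one hx10 hx1 k
  have hg3 := geom_sum_range_le_of_lt_one hx30 hx3 k
  have hA' : 0 ≤ A * (L ^ (k - 1))⁻¹ := by positivity
  have hB' : 0 ≤ B * L ^ (k - 1) := by positivity
  have hsum := add_le_add (mul_le_mul_of_nonneg_left hg1 hA') (mul_le_mul_of_nonneg_left hg3 hB')
  refine hsum.trans (le_of_eq ?_)
  -- closed forms: `L^{−(k−1)}∕(1 − q∕L) = (L²∕(L−q))·L^{−k}`, `L^{k−1}∕(1 − q∕L³) = (L²∕(L³−q))·L^{k}`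
  obtain ⟨k', rfl⟩ : ∃ k', k = k' + 1 := ⟨k - 1, by omega⟩
  simp only [Nat.add_sub_cancel]
  rw [pow_succ]
  field_simp
  ring

/-! ## §2 ★★ The joint row from per-level sources bounded by level masses, perturbed damping -/

/-- ★★ **THE JOINT ROW FROM LEVEL MASSES, DAMPING `κ ≤ q·L⁻²`**: `r_l ≤ C·M_l`, `M_l ≤ A·L^{−l} + B·L^{l}` (`l < k`; `A, B, C, E ≥ 0`, `L ≥ 2`, `0 ≤ κ ≤ q(L²)⁻¹`, `0 ≤ q < L`) ⇒
`E·Σ_{l<k} κ^{k−1−l}·r_l ≤ E·C·(A·(L²∕(L−q))·(L^k)⁻¹ + B·(L²∕(L³−q))·L^k)`. [cite: Balaban1984PropagatorsI, (1.18)-(1.20) pp.19-20; Balaban1985Averaging, (150)-(152) p.40] -/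
theorem jointRow_of_levelMasses_q (L : ℝ) (hL : 2 ≤ L) {q κ : ℝ} (hq0 : 0 ≤ q) (hqL : q < L) (hκ0 : 0 ≤ κ) (hκ : κ ≤ q * (L ^ 2)⁻¹)
    (k : ℕ) {A B C E : ℝ} (hA : 0 ≤ A) (hB : 0 ≤ B) (hC : 0 ≤ C) (hE : 0 ≤ E)
    (M r : ℕ → ℝ) (hM : ∀ l < k, M l ≤ A * (L ^ l)⁻¹ + B * L ^ l) (hr : ∀ l < k, r l ≤ C * M l) :
    E * ∑ l ∈ range k, κ ^ (k - 1 - l) * r l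
      ≤ E * C * (A * (L ^ 2 / (L - q)) * (L ^ k)⁻¹ + B * (L ^ 2 / (L ^ 3 - q)) * L ^ k) := by
  have h1 : ∑ l ∈ range k, κ ^ (k - 1 - l) * r l ≤ C * ∑ l ∈ range k, κ ^ (k - 1 - l) * M l := by
    rw [mul_sum]
    refine sum_le_sum fun l hl => ?_
    have := mul_le_mul_of_nonneg_left (hr l (mem_range.mp hl)) (pow_nonneg hκ0 (k - 1 - l))
    linarith
  have h2 := levelSum_damped_le_q L hL hq0 hqL hκ0 hκ k A B hA hB M hM
  have h3 := mul_le_mul_of_nonneg_left h2 hC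
  calc E * ∑ l ∈ range k, κ ^ (k - 1 - l) * r l ≤ E * (C * ∑ l ∈ range k, κ ^ (k - 1 - l) * M l) :=
        mul_le_mul_of_nonneg_left h1 hE
    _ ≤ E * (C * (A * (L ^ 2 / (L - q)) * (L ^ k)⁻¹ + B * (L ^ 2 / (L ^ 3 - q)) * L ^ k)) := mul_le_mul_of_nonneg_left h3 hE
    _ = _ := by ring

/-! ## §3 ★★ The joint currency, perturbed damping -/

/-- ★★ **THE JOINT CURRENCY, DAMPING `κ ≤ q·L⁻²`**: with `A = c_A·M₀` and `B = c_B·KD + c_B′·ε·((L^k)²)⁻¹·M₀`, the bound of §2 is `C₁·(L^k)⁻¹·M₀ + C₂·L^k·KD` with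
`C₁ = E·C·(c_A·L²∕(L−q) + c_B′·ε·L²∕(L³−q))`, `C₂ = E·C·c_B·L²∕(L³−q)` — the door's `C₁ℓ⁻¹M + C₂ℓK` shape, L-only once `q = q(L)`. [cite: Balaban1985Variational, Prop. 7 p.299] -/
theorem jointRow_currency_q (L : ℝ) (hL : 2 ≤ L) {q κ : ℝ} (hq0 : 0 ≤ q) (hqL : q < L) (hκ0 : 0 ≤ κ) (hκ : κ ≤ q * (L ^ 2)⁻¹)
    (k : ℕ) {cA cB cB' ε C E M₀ KD : ℝ} (hcA : 0 ≤ cA) (hcB : 0 ≤ cB) (hcB' : 0 ≤ cB') (hε : 0 ≤ ε)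
    (hC : 0 ≤ C) (hE : 0 ≤ E) (hM₀ : 0 ≤ M₀) (hKD : 0 ≤ KD)
    (M r : ℕ → ℝ) (hM : ∀ l < k, M l ≤ cA * M₀ * (L ^ l)⁻¹ + (cB * KD + cB' * ε * ((L ^ k) ^ 2)⁻¹ * M₀) * L ^ l)
    (hr : ∀ l < k, r l ≤ C * M l) :
    E * ∑ l ∈ range k, κ ^ (k - 1 - l) * r l
      ≤ E * C * (cA * (L ^ 2 / (L - q)) + cB' * ε * (L ^ 2 / (L ^ 3 - q))) * ((L ^ k)⁻¹ * M₀)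
        + E * C * cB * (L ^ 2 / (L ^ 3 - q)) * (L ^ k * KD) := by
  have hL0 : 0 < L := by linarith
  have hA : 0 ≤ cA * M₀ := mul_nonneg hcA hM₀
  have hB : 0 ≤ cB * KD + cB' * ε * ((L ^ k) ^ 2)⁻¹ * M₀ := by positivity
  have h := jointRow_of_levelMasses_q L hL hq0 hqL hκ0 hκ k hA hB hC hE M r hM hr
  have hLk : (L ^ k) ≠ 0 := pow_ne_zero _ hL0.ne'
  have hLq : L - q ≠ 0 := by linarith
  have hL3 : L ≤ L ^ 3 := by nlinarith [sq_nonneg L, hL0]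
  have hL3q : L ^ 3 - q ≠ 0 := by linarith
  have e : E * C * (cA * M₀ * (L ^ 2 / (L - q)) * (L ^ k)⁻¹ + (cB * KD + cB' * ε * ((L ^ k) ^ 2)⁻¹ * M₀) * (L ^ 2 / (L ^ 3 - q)) * L ^ k)
      = E * C * (cA * (L ^ 2 / (L - q)) + cB' * ε * (L ^ 2 / (L ^ 3 - q))) * ((L ^ k)⁻¹ * M₀)
        + E * C * cB * (L ^ 2 / (L ^ 3 - q)) * (L ^ k * KD) := by
    field_simp
    ring
  rw [← e]
  exact h

end Summit.QuantumFields.YangMills.Theorems.Prop7JointRowOfLevelMassesQ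

end
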